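import Summits.HubbardSuperconductivity.HubbardSuperconductivity.Theorems.NodalWardXYNodalReductionOfOrderWindow
import Summits.HubbardSuperconductivity.HubbardSuperconductivity.Theses.WeakCouplingBCS

/-!
# Crux `NodalWardXY.NodalReduction` (stmt-HubbardSuperconductivity-1268) ⇐ crux `WeakCouplingBCS.WcbcsBcsConstruction`
# (stmt-HubbardSuperconductivity-2010), BY NAME

Line `Sketch`, lead seat c15-0 (2026-08-17). The structural closing edge
`Theorems.NodalReduction.nodalReduction_of_bcsConstruction` (p96085) takes the BODY of the sibling crux
`WeakCouplingBCS.WcbcsBcsConstruction` spelled out token for token. This file records the same implication with the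
hypothesis named as the route item itself, so that the dependency "stmt-1268 is proved the moment stmt-2010 is" is a
kernel-checked, ledger-visible CONDITIONAL result (the audit classifies it `proof.conditional` on the registered
hypothesis `Theses.WeakCouplingBCS.WcbcsBcsConstruction`) rather than prose in seventeen lead seats' notes.

It asserts nothing new: `WcbcsBcsConstruction` (one doping `δ ∈ (0,1/2)`, a window `U ∈ (0,U₀)`, a density-matched `μ`
and the BCS floor `e^{−C/U²} ≤ dWaveOrderParameter U μ`) is definitionally the hypothesis of
`nodalReduction_of_bcsConstruction`, and `0 < e^{−C/U²}` turns the floor into `HasDWaveOrder U μ`, i.e. the window, in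
front of which both engine hypotheses (`VisonPairCost`, proved; `PerturbedXYOrder`) are logically idle.

Importing `Theses.WeakCouplingBCS` here closes no import cycle: this module closes no item of route `WeakCouplingBCS`
(whose header forbids the import only for files the gate links back into that Theses file).
-/

noncomputable section

-- `Summit.HubbardSuperconductivity.HubbardSuperconductivity.…` is the tree's summit/sub-problem namespace (D-0017).
set_option linter.dupNamespace false

namespace Summit.HubbardSuperconductivity.HubbardSuperconductivity.Theorems.NodalReduction

open Summit.HubbardSuperconductivity.HubbardSuperconductivity.Theses

/-- **Crux 1268 conditional on crux 2010, by name.** The weak-coupling d-wave BCS construction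
`WeakCouplingBCS.WcbcsBcsConstruction` (stmt-HubbardSuperconductivity-2010) implies `NodalWardXY.NodalReduction`
(stmt-HubbardSuperconductivity-1268): its body is literally the hypothesis of the landed edge
`nodalReduction_of_bcsConstruction` (floor `e^{−C/U²} > 0` ⇒ `HasDWaveOrder` ⇒ the window ⇒ the crux). Conditional result:
the hypothesis is an OPEN crux of route `WeakCouplingBCS`; nothing is claimed about it here. -/
theorem nodalReduction_of_wcbcs (h : WeakCouplingBCS.WcbcsBcsConstruction) : NodalWardXY.NodalReduction :=
  nodalReduction_of_bcsConstruction h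

/-- Contrapositive bookkeeping: a refutation of crux 1268 would refute crux 2010 as well (so the two cruxes cannot be
settled in opposite directions). -/
theorem not_wcbcs_of_not_nodalReduction (h : ¬ NodalWardXY.NodalReduction) : ¬ WeakCouplingBCS.WcbcsBcsConstruction :=
  fun hw => h (nodalReduction_of_wcbcs hw)

end Summit.HubbardSuperconductivity.HubbardSuperconductivity.Theorems.NodalReduction

end
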